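import Mathlib
import HarnessLib

/-!
# Crux `PrintCf2.SplitBadTwoRankOneOfFacts` (stmt-BirchSwinnertonDyer-20368), S3n′ divisibility road, leaf (ii)_nr — ALGEBRA SOCKET:
# a `Λ = ℤ_p⟦T⟧`-dual of a discrete module that is `(γ^{pⁿ} − 1)`-divisible FOR EVERY `n` has NO non-zero finite
# `Λ`-submodule (indeed no non-zero `ω_n`-torsion, `ω_n = (1+T)^{pⁿ} − 1`)

Cell `bsd-print-cf2`, WIDTH seat `bsd-line-cf2-p1-w2` g14 (prover-bsd-line-cf2-p1-w2-g14-0); `--supports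
stmt-BirchSwinnertonDyer-20368` (helper, Theses-free). HONEST FRAMING: nothing here closes the crux or a registered stub;
BSD is not proved by any of this; no summit statement is proved by this seat. No definition, no named fact, no `sorry`.
Pure algebra (Mathlib only).

WHY (memo `Cruxes/SplitBadTwoRankOneOfFacts/S3N-FACTFREE-w2g14.md` §4, last bullet; -w7 g5's leaf (ii)_nr of
`NoPseudoNullOfLine.pseudoNullFinite_two_of_H2_of_unramifiedDual_of_lift`, hypothesis `∀ N : Submodule Λ Y, Finite N → N = ⊥`
for a `Λ`-dual datum `(Y, dY)` of the ambient `H_nr(K*_∞, A_θ)` with `dY (T • y) c = dY y (conj_{γ₂} c) − dY y c`): that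
hypothesis follows from the LAYERWISE divisibility «`conj_{γ₂}^{pⁿ} − 1` maps `H_nr` onto `H_nr` for every `n`» — which is what the
fact-free road produces layer by layer (Tate's `H²(Gal(K̄/K*_n), A_θ) = 0`, -w2 g13, + the `(γ₂^{pⁿ} − 1)`-lift at the layer
`K*_n`, bricks R2/R3) — by the algebra of this file:

* §1 `prime_pow_dvd_choose_prime_pow_add` — `p^m ∣ binom(p^{m+m}, j)` for `0 < j < m` (Kummer: `v_p binom(pⁿ, j) = n − v_p(j)`).
* §2 `omega_smul_eq_zero_of_torsion` — if `p^m • y = 0` and `T^m • y = 0` then `((1+T)^{p^{m+m}} − 1) • y = 0`.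
* §3 `exists_pow_smul_eq_zero_of_finite` — a FINITE `Λ`-submodule is killed by `p^m` and `T^m` for some `m` (`p`-primary by the
  `ℤ_p`-structure; `T`-part by Nakayama on the Artinian module, `T ∈ 𝔪_Λ`).
* §4 `eq_zero_of_omega_smul_eq_zero_of_surjective` — for a dual datum `dY : Y →+ (S →+ A)` (injective, `dY (T • y) = dY y ∘ φ − dY y`):
  if `φ^{pⁿ} − 1` is onto `S` then `((1+T)^{pⁿ} − 1) • y = 0 ⟹ y = 0` (`Y^{Γ_n} = 0`).
* §5 **`submodule_eq_bot_of_finite_of_forall_surjective`** — hence `φ^{pⁿ} − 1` onto for every `n` ⟹ every finite `Λ`-submodule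
  of `Y` is `⊥`.
beyond-print theorem: no (folklore: Greenberg LNM 1716 §4; Perrin-Riou). presearch: memo §5.

References: R. Greenberg, *Iwasawa theory for elliptic curves*, LNM 1716 (1999) §4 (Props. 4.14–4.15); J. Neukirch, A. Schmidt,
K. Wingberg, *Cohomology of Number Fields* (5.3.19).
-/

noncomputable section

set_option linter.dupNamespace false
set_option autoImplicit false

open scoped Classical
open PowerSeries

namespace Summit.BirchSwinnertonDyer.BirchSwinnertonDyer.Theorems.PrintCf2.KummerProNull

variable {p : ℕ} [hp : Fact p.Prime]

/-! ## §1. `p^m ∣ binom(p^{m+m}, j)` for `0 < j < m` -/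

/-- Kummer: `v_p binom(pⁿ, j) = n − v_p(j)`; with `v_p(j) < j < m` and `n = m + m` this is `> m`. [folklore] -/
theorem prime_pow_dvd_choose_prime_pow_add {m j : ℕ} (hj0 : 0 < j) (hjm : j < m) :
    p ^ m ∣ (p ^ (m + m)).choose j := by
  have hP : p.Prime := hp.out
  have hjle : j ≤ p ^ (m + m) :=
    (hjm.le.trans (Nat.le_add_right m m)).trans (Nat.lt_pow_self hP.one_lt).le
  have hmult : multiplicity p j < m := by
    have hfin : FiniteMultiplicity p j := Nat.finiteMultiplicity_iff.mpr ⟨hP.ne_one, hj0⟩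
    have hdvd : p ^ multiplicity p j ∣ j := pow_multiplicity_dvd p j
    have hle : p ^ multiplicity p j ≤ j := Nat.le_of_dvd hj0 hdvd
    have hlt : multiplicity p j < p ^ multiplicity p j := Nat.lt_pow_self hP.one_lt
    omega
  rw [pow_dvd_iff_le_emultiplicity, hP.emultiplicity_choose_prime_pow hjle hj0.ne']
  exact_mod_cast (by omega : m ≤ m + m - multiplicity p j)

/-! ## §2. `ω_n = (1+T)^{pⁿ} − 1` kills `(p^m, T^m)`-torsion for `n = m + m` -/

section Omega

variable {Y : Type*} [AddCommGroup Y] [Module (PowerSeries ℤ_[p]) Y]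

/-- `(1 + T)^N − 1 = ∑_{0 < j ≤ N} binom(N, j) T^j` acting on `y`: if `p^m • y = 0` and `T^m • y = 0` then
`((1+T)^{p^{m+m}} − 1) • y = 0` (terms `j ≥ m` die by `T^m`, terms `0 < j < m` by `p^m ∣ binom`). [folklore] -/
theorem omega_smul_eq_zero_of_torsion {m : ℕ} {y : Y} (hpy : (p ^ m : ℕ) • y = 0)
    (hTy : (X : PowerSeries ℤ_[p]) ^ m • y = 0) :
    (((1 : PowerSeries ℤ_[p]) + X) ^ p ^ (m + m) - 1) • y = 0 := by
  set N : ℕ := p ^ (m + m) with hN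
  -- binomial expansion, split off `j = 0`
  have hexp : ((1 : PowerSeries ℤ_[p]) + X) ^ N - 1 =
      ∑ j ∈ (Finset.range (N + 1)).erase 0, (X : PowerSeries ℤ_[p]) ^ j * (N.choose j : PowerSeries ℤ_[p]) := by
    rw [add_comm, add_pow]
    simp only [one_pow, mul_one]
    rw [← Finset.add_sum_erase _ _ (Finset.mem_range.mpr (Nat.succ_pos N)), pow_zero, Nat.choose_zero_right,
      Nat.cast_one, one_mul, add_sub_cancel_left]
  rw [hexp, Finset.sum_smul]
  refine Finset.sum_eq_zero fun j hj ↦ ?_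
  obtain ⟨hj0, -⟩ := Finset.mem_erase.mp hj
  by_cases hjm : m ≤ j
  · -- `T^j • y = T^{j-m} • T^m • y = 0`
    obtain ⟨d, rfl⟩ := Nat.exists_eq_add_of_le hjm
    rw [mul_comm, mul_smul, pow_add, mul_comm, mul_smul, hTy, smul_zero, smul_zero]
  · -- `binom = p^m c`, `(p^m c) • y = 0`
    rw [not_le] at hjm
    obtain ⟨c, hc⟩ := prime_pow_dvd_choose_prime_pow_add (p := p) (Nat.pos_of_ne_zero hj0) hjm
    rw [mul_smul, hc, Nat.cast_mul, mul_comm, mul_smul, Nat.cast_pow]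
    have : ((p : PowerSeries ℤ_[p]) ^ m) • y = 0 := by
      rw [← Nat.cast_pow, Nat.cast_smul_eq_nsmul]; exact hpy
    rw [this, smul_zero, smul_zero]

/-! ## §3. A finite `Λ`-submodule is killed by `p^m` and `T^m` -/

/-- `T ∈ 𝔪_Λ`. [folklore] -/
theorem X_mem_maximalIdeal : (X : PowerSeries ℤ_[p]) ∈ IsLocalRing.maximalIdeal (PowerSeries ℤ_[p]) := by
  rw [IsLocalRing.mem_maximalIdeal, mem_nonunits_iff, PowerSeries.isUnit_iff_constantCoeff]
  simp

/-- **A FINITE `Λ`-submodule `N ≤ Y` is killed by `p^m` and by `T^m` for some `m`**: additively `N` is a finite group on which the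
units of `ℤ_p` prime to `p` act invertibly, so its exponent is a power of `p`; and the chain `Tᵏ N` stabilises (finite!), whence
`Tᵏ N = 0` by Nakayama (`T ∈ 𝔪_Λ`). [folklore] -/
theorem exists_pow_smul_eq_zero_of_finite (N : Submodule (PowerSeries ℤ_[p]) Y) [Finite N] :
    ∃ m : ℕ, ∀ y ∈ N, (p ^ m : ℕ) • y = 0 ∧ (X : PowerSeries ℤ_[p]) ^ m • y = 0 := by
  have hP : p.Prime := hp.out
  -- `p`-part
  obtain ⟨a, ha⟩ : ∃ a : ℕ, ∀ y ∈ N, (p ^ a : ℕ) • y = 0 := by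
    set n : ℕ := Nat.card N with hn
    have hn0 : n ≠ 0 := Nat.card_pos.ne'
    refine ⟨n.factorization p, fun y hy ↦ ?_⟩
    set c : ℕ := n / p ^ n.factorization p with hc
    have hnc : p ^ n.factorization p * c = n := Nat.ordProj_mul_ordCompl_eq_self n p
    have hcop : Nat.Coprime p c := Nat.coprime_ordCompl hP hn0
    -- `n • y = 0`
    have hny : n • y = 0 := by
      obtain ⟨d, hd⟩ := addOrderOf_dvd_natCard (⟨y, hy⟩ : N)
      have h' : n • (⟨y, hy⟩ : N) = 0 := by
        rw [hn, hd, mul_nsmul, addOrderOf_nsmul_eq_zero, nsmul_zero]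
      exact congrArg Subtype.val h'
    -- `c` is a unit of `ℤ_p`
    have hcunit : IsUnit ((c : ℤ) : ℤ_[p]) := by
      rw [PadicInt.isUnit_iff]
      refine le_antisymm (PadicInt.norm_le_one _) (not_lt.mp fun hlt ↦ ?_)
      rw [PadicInt.norm_int_lt_one_iff_dvd] at hlt
      have : p ∣ c := by exact_mod_cast hlt
      exact hP.one_lt.ne' (Nat.Coprime.eq_one_of_dvd hcop this)
    -- `(p^a • y)` is killed by the unit `c` (acting through `C : ℤ_p → Λ`), hence is `0`
    obtain ⟨u, hu⟩ := hcunit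
    have hcy : (PowerSeries.C ((c : ℤ) : ℤ_[p])) • ((p ^ n.factorization p : ℕ) • y) = 0 := by
      rw [← Nat.cast_smul_eq_nsmul (PowerSeries ℤ_[p]) (p ^ n.factorization p), ← mul_smul, Int.cast_natCast,
        map_natCast, ← Nat.cast_mul, mul_comm, hnc, Nat.cast_smul_eq_nsmul, hny]
    have : (p ^ n.factorization p : ℕ) • y = (PowerSeries.C ((u⁻¹ : ℤ_[p]ˣ) : ℤ_[p])) •
        ((PowerSeries.C ((u : ℤ_[p]ˣ) : ℤ_[p])) • ((p ^ n.factorization p : ℕ) • y)) := by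
      rw [← mul_smul, ← map_mul, Units.inv_mul, map_one, one_smul]
    rw [this, hu, hcy, smul_zero]
  -- `T`-part: Nakayama on the Artinian (finite) module `↥N`
  obtain ⟨k, hk⟩ : ∃ k : ℕ, ∀ y ∈ N, (X : PowerSeries ℤ_[p]) ^ k • y = 0 := by
    set I : Ideal (PowerSeries ℤ_[p]) := Ideal.span {X} with hI
    haveI : IsArtinian (PowerSeries ℤ_[p]) N := isArtinian_of_finite
    -- the decreasing chain `I^k • ⊤`
    let f : ℕ →o (Submodule (PowerSeries ℤ_[p]) N)ᵒᵈ :=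
      ⟨fun k ↦ OrderDual.toDual (I ^ k • (⊤ : Submodule (PowerSeries ℤ_[p]) N)), fun k l hkl ↦
        OrderDual.toDual_le_toDual.mpr (Submodule.smul_mono_left (Ideal.pow_le_pow_right hkl))⟩
    obtain ⟨k, hk⟩ := IsArtinian.monotone_stabilizes f
    have hstab : I ^ k • (⊤ : Submodule (PowerSeries ℤ_[p]) N) = I ^ (k + 1) • ⊤ := by
      have := hk (k + 1) (Nat.le_succ k)
      exact congrArg OrderDual.ofDual this
    have hzero : I ^ k • (⊤ : Submodule (PowerSeries ℤ_[p]) N) = ⊥ := by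
      refine Submodule.eq_bot_of_le_smul_of_le_jacobson_bot I _ (Submodule.FG.of_finite) ?_ ?_
      · rw [← Submodule.smul_assoc, smul_eq_mul, ← pow_succ', ← hstab]
      · rw [IsLocalRing.jacobson_eq_maximalIdeal ⊥ bot_ne_top, hI, Ideal.span_le, Set.singleton_subset_iff]
        exact X_mem_maximalIdeal
    refine ⟨k, fun y hy ↦ ?_⟩
    have hmem : (X : PowerSeries ℤ_[p]) ^ k • (⟨y, hy⟩ : N) ∈ I ^ k • (⊤ : Submodule (PowerSeries ℤ_[p]) N) :=
      Submodule.smul_mem_smul (Ideal.pow_mem_pow (Ideal.mem_span_singleton_self X) k) Submodule.mem_top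
    rw [hzero, Submodule.mem_bot] at hmem
    exact congrArg Subtype.val hmem
  refine ⟨max a k, fun y hy ↦ ⟨?_, ?_⟩⟩
  · obtain ⟨d, hd⟩ := Nat.exists_eq_add_of_le (le_max_left a k)
    rw [hd, pow_add, mul_nsmul, ha y hy, nsmul_zero]
  · obtain ⟨d, hd⟩ := Nat.exists_eq_add_of_le (le_max_right a k)
    rw [hd, pow_add, mul_comm, mul_smul, hk y hy, smul_zero]

/-! ## §4. `ω_n`-torsion of a divisible dual vanishes -/

variable {S : Type*} [AddCommGroup S] {A : Type*} [AddCommGroup A]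

/-- The twisting law iterated: `dY ((1+T)^j • y) c = dY y (φ^j c)`. [folklore] -/
theorem dual_one_add_X_pow_smul (φ : AddMonoid.End S) (dY : Y →+ (S →+ A))
    (hT : ∀ (y : Y) (c : S), dY ((X : PowerSeries ℤ_[p]) • y) c = dY y (φ c) - dY y c) (j : ℕ) (y : Y) (c : S) :
    dY ((((1 : PowerSeries ℤ_[p]) + X) ^ j) • y) c = dY y ((φ ^ j) c) := by
  induction j generalizing c with
  | zero => simp
  | succ j ih =>
    rw [pow_succ' ((1 : PowerSeries ℤ_[p]) + X), mul_smul, add_smul, one_smul, map_add, AddMonoidHom.add_apply, hT, ih,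
      ih, pow_succ, AddMonoid.End.coe_mul, Function.comp_apply]
    abel

/-- **`Y[ω_n] = 0` when `φ^{pⁿ} − 1` is onto `S`** (`ω_n = (1+T)^{pⁿ} − 1`): for an injective dual datum `dY : Y →+ (S →+ A)` with
`dY (T • y) = dY y ∘ φ − dY y`, `ω_n • y = 0` forces `dY y` to vanish on the image of `φ^{pⁿ} − 1`, i.e. everywhere.
[cite: GreenbergLNM1716, §4 (proof of Prop. 4.14)] -/
theorem eq_zero_of_omega_smul_eq_zero_of_surjective (φ : AddMonoid.End S) (dY : Y →+ (S →+ A))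
    (hinj : Function.Injective dY)
    (hT : ∀ (y : Y) (c : S), dY ((X : PowerSeries ℤ_[p]) • y) c = dY y (φ c) - dY y c) {n : ℕ}
    (hsurj : ∀ s : S, ∃ t : S, (φ ^ p ^ n) t - t = s) {y : Y}
    (hy : (((1 : PowerSeries ℤ_[p]) + X) ^ p ^ n - 1) • y = 0) : y = 0 := by
  apply hinj
  rw [map_zero]
  ext s
  obtain ⟨t, rfl⟩ := hsurj s
  have h := congrArg (fun z ↦ dY z t) hy
  simp only [sub_smul, one_smul, map_sub, map_zero, AddMonoidHom.sub_apply, AddMonoidHom.zero_apply,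
    dual_one_add_X_pow_smul φ dY hT] at h
  rw [map_sub, AddMonoidHom.zero_apply]
  exact h

/-! ## §5. No finite submodules -/

/-- **A `Λ`-dual that is `(φ^{pⁿ} − 1)`-divisible for EVERY `n` has no non-zero finite `Λ`-submodule.** For an injective dual
datum `dY : Y →+ (S →+ A)` with `dY (T • y) = dY y ∘ φ − dY y`: if `φ^{pⁿ} − 1` maps `S` onto `S` for every `n`, then every finite
`Λ`-submodule `N ≤ Y` is `⊥` (it is killed by some `ω_{m+m}`, §§2–3, and `Y[ω] = 0`, §4). This is the hypothesis
`∀ N, Finite N → N = ⊥` of leaf (ii)_nr of `NoPseudoNullOfLine.pseudoNullFinite_two_of_H2_of_unramifiedDual_of_lift` from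
layerwise divisibility. [cite: GreenbergLNM1716, §4 Props. 4.14–4.15] -/
theorem submodule_eq_bot_of_finite_of_forall_surjective (φ : AddMonoid.End S) (dY : Y →+ (S →+ A))
    (hinj : Function.Injective dY)
    (hT : ∀ (y : Y) (c : S), dY ((X : PowerSeries ℤ_[p]) • y) c = dY y (φ c) - dY y c)
    (hsurj : ∀ (n : ℕ) (s : S), ∃ t : S, (φ ^ p ^ n) t - t = s)
    (N : Submodule (PowerSeries ℤ_[p]) Y) (hN : Finite N) : N = ⊥ := by
  haveI := hN
  obtain ⟨m, hm⟩ := exists_pow_smul_eq_zero_of_finite (p := p) N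
  rw [eq_bot_iff]
  intro y hy
  rw [Submodule.mem_bot]
  obtain ⟨hpy, hTy⟩ := hm y hy
  exact eq_zero_of_omega_smul_eq_zero_of_surjective φ dY hinj hT (hsurj (m + m))
    (omega_smul_eq_zero_of_torsion hpy hTy)

end Omega

end Summit.BirchSwinnertonDyer.BirchSwinnertonDyer.Theorems.PrintCf2.KummerProNull

end
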